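import Summits.BirchSwinnertonDyer.BirchSwinnertonDyer.Theorems.ManinLocalTwoThreeIstarSuccNeronScalar
import HarnessLib

/-!
# E-an-109 on the potentially multiplicative tame stratum `Iₙ*` (`n ≥ 1`), COMPLETE: `u = 3 ⟺ ord₃ D₀ = 0`, `u = 1 ⟺ ord₃ D₀ ≥ 3`

Summit `BirchSwinnertonDyer`, route `ManinLocalTwoThree` (cell bsd-f2-manin), deciding crux C3 `ManinPrimeToThreeAtNine`
(stmt-BirchSwinnertonDyer-22968).  Sequel of p655261/p655498 (`Iₙ*`: `ord₃ D₀ = 0 ⟹ u = 3`).  The open branch `ord₃ D₀ ≥ 3` closes by one more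
line of the normal-form computation: there `3 ∣ x`, `12x + b₂ = 3·(12z + B₂)` with `B₂ ≡ α₂` a UNIT (`3 ∥ a₂` on `Iₙ*`, `n ≥ 1`), and
`9c₄ = 81(B₂² − 72B₄)`, so `A = 9·unit`: `ord₃ A = 2` EXACTLY.  A `u = 3` carrier would have `c₄ = 3⁻⁴A` of negative `3`-order — impossible
for a globally minimal (integral) curve; so the carrier of the dichotomy p648212 has `k = ±1`:

`veluD₀_dichotomy_of_IstarSucc_three'` ((`ord₃ D₀ = 0` ∧ …) ∨ (`ord₃ D₀ ≥ 3` ∧ `ord₃ A = 2`)), `IstarSucc_velu_three_of_three_le_D₀` (`⟹ u = 1`),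
`IstarSucc_neronScalar_dichotomy` (both branches).  HONEST FRAMING: local structure; C3, Manin's conjecture and BSD are not proved.  No definitions,
no named facts, no sorry.  References: [SilvermanATAEC1994] IV.9.4 Step 7, Table 4.1; [DokchitserDokchitser2015LocalInvariants] Table 1; MEMO-an §66.
-/

set_option linter.dupNamespace false
set_option autoImplicit false

noncomputable section

open scoped Classical

open WeierstrassCurve IsDedekindDomain IsLocalRing Polynomial NumberField Rat.HeightOneSpectrum CongruenceSubgroup
  Literature.NumberTheory.DiophantineGeometry Literature.NumberTheory.DiophantineGeometry.TateAlgorithm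
  Literature.NumberTheory.EllipticCurves Literature.NumberTheory.EllipticCurves.LocalIndex
  Literature.NumberTheory.EllipticCurves.ModularForms
  Summit.BirchSwinnertonDyer.Rank1Residual.Additive
open IsDiscreteValuationRing hiding maximalIdeal

namespace Summit.BirchSwinnertonDyer.BirchSwinnertonDyer.Theorems.ManinLocalTwoThree

/-! ### §1 The normal form with `α₂ ∈ ℤ₃ˣ` and the sharpened dichotomy -/

/-- Tate's `Iₙ*` (`n ≥ 1`) normal form over `ℤ₃` with the unit `α₂` (`3 ∥ a₂`). [cite: SilvermanATAEC1994, IV.9.4 Step 7] -/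
theorem exists_IstarSuccNormalForm_padicInt_three' (V : WeierstrassCurve ℤ_[3]) {n : ℕ} (hV : V.kodairaSymbolOfMinimal = .Istar (n + 1)) :
    ∃ (D : VariableChange ℤ_[3]) (α₁ α₂ α₃ α₄ α₆ : ℤ_[3]),
      (D • V).a₁ = 3 * α₁ ∧ (D • V).a₂ = 3 * α₂ ∧ IsUnit α₂ ∧ (D • V).a₃ = 9 * α₃ ∧ (D • V).a₄ = 27 * α₄ ∧ (D • V).a₆ = 81 * α₆ := by
  haveI : Finite (ResidueField ℤ_[3]) := Finite.of_equiv _ (PadicInt.residueField (p := 3)).toEquiv.symm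
  have hirr : Irreducible (3 : ℤ_[3]) := by exact_mod_cast PadicInt.irreducible_p (p := 3)
  obtain ⟨D, h1, h2, h2', h3, h4, h6⟩ := exists_smul_of_kodairaSymbolOfMinimal_eq_Istar_succ V hV
  obtain ⟨α₁, hα₁⟩ := (mem_maximalIdeal_iff_dvd_of_irreducible hirr _).mp h1
  obtain ⟨α₂, hα₂⟩ := (mem_maximalIdeal_iff_dvd_of_irreducible hirr _).mp h2
  obtain ⟨α₃, hα₃⟩ := (mem_maximalIdeal_pow_iff_dvd_of_irreducible hirr _ _).mp h3
  obtain ⟨α₄, hα₄⟩ := (mem_maximalIdeal_pow_iff_dvd_of_irreducible hirr _ _).mp h4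
  obtain ⟨α₆, hα₆⟩ := (mem_maximalIdeal_pow_iff_dvd_of_irreducible hirr _ _).mp h6
  have hα₂u : IsUnit α₂ := by
    by_contra hnu
    obtain ⟨β, hβ⟩ := padicInt_three_eq_three_mul_of_not_isUnit hnu
    exact h2' ((mem_maximalIdeal_pow_iff_dvd_of_irreducible hirr _ _).mpr ⟨β, by rw [hα₂, hβ]; ring⟩)
  exact ⟨D, α₁, α₂, α₃, α₄, α₆, hα₁, hα₂, hα₂u, by rw [hα₃]; ring, by rw [hα₄]; ring, by rw [hα₆]; ring⟩

/-- **The `Iₙ*` root dichotomy, sharpened in the non-unit case** (`α₂ ∈ ℤ₃ˣ`, i.e. `3 ∥ a₂`): if `3 ∣ x` then `‖A‖ = 3⁻²` exactly.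
The unit case is as in  On a `ℤ₃`-model `[3α₁, 3α₂, 9α₃, 27α₄, 81α₆]`, a root `x ∈ ℚ₃` of `3x⁴ + b₂x³ + 3b₄x² + 3b₆x + b₈` is
integral, and either `D = 4x³ + b₂x² + 2b₄x + b₆` is a unit with `‖10(12x + b₂)² − 9c₄‖ ≤ 3⁻⁶`, or `‖D‖ ≤ 3⁻³`.
[cite: SilvermanATAEC1994, IV.9.4 Step 7] -/
theorem IstarSucc_root_dichotomy_padicInt' (M : WeierstrassCurve ℤ_[3]) {α₁ α₂ α₃ α₄ α₆ : ℤ_[3]} (h₁ : M.a₁ = 3 * α₁)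
    (h₂ : M.a₂ = 3 * α₂) (hα₂ : IsUnit α₂) (h₃ : M.a₃ = 9 * α₃) (h₄ : M.a₄ = 27 * α₄) (h₆ : M.a₆ = 81 * α₆) {x : ℚ_[3]}
    (hx : 3 * x ^ 4 + (M.map PadicInt.Coe.ringHom).b₂ * x ^ 3 + 3 * (M.map PadicInt.Coe.ringHom).b₄ * x ^ 2 +
      3 * (M.map PadicInt.Coe.ringHom).b₆ * x + (M.map PadicInt.Coe.ringHom).b₈ = 0) :
    (‖4 * x ^ 3 + (M.map PadicInt.Coe.ringHom).b₂ * x ^ 2 + 2 * (M.map PadicInt.Coe.ringHom).b₄ * x +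
        (M.map PadicInt.Coe.ringHom).b₆‖ = 1 ∧
      ‖10 * (12 * x + (M.map PadicInt.Coe.ringHom).b₂) ^ 2 - 9 * (M.map PadicInt.Coe.ringHom).c₄‖ ≤ 3⁻¹ ^ 6) ∨
    (‖4 * x ^ 3 + (M.map PadicInt.Coe.ringHom).b₂ * x ^ 2 + 2 * (M.map PadicInt.Coe.ringHom).b₄ * x +
        (M.map PadicInt.Coe.ringHom).b₆‖ ≤ 3⁻¹ ^ 3 ∧
      ‖10 * (12 * x + (M.map PadicInt.Coe.ringHom).b₂) ^ 2 - 9 * (M.map PadicInt.Coe.ringHom).c₄‖ = 3⁻¹ ^ 2) := by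
  obtain ⟨hb₂, hb₄, hb₆, hb₈, hc₄⟩ := map_b_of_IstarSuccNormalForm M h₁ h₂ h₃ h₄ h₆
  set B₂ : ℤ_[3] := 3 * α₁ ^ 2 + 4 * α₂ with hB₂
  set B₄ : ℤ_[3] := 2 * α₄ + α₁ * α₃ with hB₄
  set B₆ : ℤ_[3] := α₃ ^ 2 + 4 * α₆ with hB₆
  set B₈ : ℤ_[3] := 3 * α₁ ^ 2 * α₆ + 4 * α₂ * α₆ - 3 * α₁ * α₃ * α₄ + α₂ * α₃ ^ 2 - 3 * α₄ ^ 2 with hB₈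
  rw [hb₂, hb₄, hb₆, hb₈] at hx
  rw [hb₂, hb₄, hb₆, hc₄]
  have c3 : ((3 : ℤ_[3]) : ℚ_[3]) = 3 := by exact_mod_cast PadicInt.coe_natCast 3
  have c4 : ((4 : ℤ_[3]) : ℚ_[3]) = 4 := by exact_mod_cast PadicInt.coe_natCast 4
  have c10 : ((10 : ℤ_[3]) : ℚ_[3]) = 10 := by exact_mod_cast PadicInt.coe_natCast 10
  have c12 : ((12 : ℤ_[3]) : ℚ_[3]) = 12 := by exact_mod_cast PadicInt.coe_natCast 12
  have c27 : ((27 : ℤ_[3]) : ℚ_[3]) = 27 := by exact_mod_cast PadicInt.coe_natCast 27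
  have c54 : ((54 : ℤ_[3]) : ℚ_[3]) = 54 := by exact_mod_cast PadicInt.coe_natCast 54
  have c72 : ((72 : ℤ_[3]) : ℚ_[3]) = 72 := by exact_mod_cast PadicInt.coe_natCast 72
  have c81 : ((81 : ℤ_[3]) : ℚ_[3]) = 81 := by exact_mod_cast PadicInt.coe_natCast 81
  have c243 : ((243 : ℤ_[3]) : ℚ_[3]) = 243 := by exact_mod_cast PadicInt.coe_natCast 243
  have c729 : ((729 : ℤ_[3]) : ℚ_[3]) = 729 := by exact_mod_cast PadicInt.coe_natCast 729
  have hirr : Irreducible (3 : ℤ_[3]) := by exact_mod_cast PadicInt.irreducible_p (p := 3)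
  have h3n : ‖(3 : ℚ_[3])‖ = 3⁻¹ := by have := Padic.norm_p (p := 3); exact_mod_cast this
  have hm1 : ∀ m : ℤ_[3], ‖(m : ℚ_[3])‖ ≤ 1 := fun m => by rw [← PadicInt.norm_def]; exact PadicInt.norm_le_one m
  -- (i) `x` is a `3`-adic integer
  have hxle : ‖x‖ ≤ 1 := by
    by_contra hlt
    rw [not_le] at hlt
    have hlead : ‖3 * x ^ 4‖ = 3⁻¹ * ‖x‖ ^ 4 := by rw [norm_mul, norm_pow, h3n]
    have e : 3 * x ^ 4 = -((3 * (B₂ : ℚ_[3])) * x ^ 3 + 3 * (27 * (B₄ : ℚ_[3])) * x ^ 2 + 3 * (81 * (B₆ : ℚ_[3])) * x +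
        243 * (B₈ : ℚ_[3])) := by linear_combination hx
    have hx1 : (1 : ℝ) ≤ ‖x‖ := hlt.le
    have t1 : ‖(3 * (B₂ : ℚ_[3])) * x ^ 3‖ < 3⁻¹ * ‖x‖ ^ 4 := by
      rw [norm_mul, norm_mul, norm_pow, h3n]
      calc 3⁻¹ * ‖(B₂ : ℚ_[3])‖ * ‖x‖ ^ 3 ≤ 3⁻¹ * 1 * ‖x‖ ^ 3 := by gcongr; exact hm1 _
        _ < 3⁻¹ * ‖x‖ ^ 4 := by
          rw [mul_one]
          have : ‖x‖ ^ 3 < ‖x‖ ^ 4 := by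
            calc ‖x‖ ^ 3 = ‖x‖ ^ 3 * 1 := by ring
              _ < ‖x‖ ^ 3 * ‖x‖ := by gcongr
              _ = ‖x‖ ^ 4 := by ring
          linarith
    have t2 : ‖3 * (27 * (B₄ : ℚ_[3])) * x ^ 2‖ < 3⁻¹ * ‖x‖ ^ 4 := by
      rw [norm_mul, norm_mul, norm_mul, norm_pow, h3n, show (27 : ℚ_[3]) = 3 ^ 3 by norm_num, norm_pow, h3n]
      calc 3⁻¹ * ((3⁻¹) ^ 3 * ‖(B₄ : ℚ_[3])‖) * ‖x‖ ^ 2 ≤ 3⁻¹ * ((3⁻¹) ^ 3 * 1) * ‖x‖ ^ 2 := by gcongr; exact hm1 _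
        _ < 3⁻¹ * ‖x‖ ^ 4 := by
          have : ‖x‖ ^ 2 ≤ ‖x‖ ^ 4 := pow_le_pow_right₀ hx1 (by norm_num)
          nlinarith
    have t3 : ‖3 * (81 * (B₆ : ℚ_[3])) * x‖ < 3⁻¹ * ‖x‖ ^ 4 := by
      rw [norm_mul, norm_mul, norm_mul, h3n, show (81 : ℚ_[3]) = 3 ^ 4 by norm_num, norm_pow, h3n]
      calc 3⁻¹ * ((3⁻¹) ^ 4 * ‖(B₆ : ℚ_[3])‖) * ‖x‖ ≤ 3⁻¹ * ((3⁻¹) ^ 4 * 1) * ‖x‖ := by gcongr; exact hm1 _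
        _ < 3⁻¹ * ‖x‖ ^ 4 := by
          have : ‖x‖ ≤ ‖x‖ ^ 4 := le_self_pow₀ hx1 (by norm_num)
          nlinarith
    have t4 : ‖243 * (B₈ : ℚ_[3])‖ < 3⁻¹ * ‖x‖ ^ 4 := by
      rw [norm_mul, show (243 : ℚ_[3]) = 3 ^ 5 by norm_num, norm_pow, h3n]
      have hx4 : (1 : ℝ) ≤ ‖x‖ ^ 4 := one_le_pow₀ hx1
      calc (3⁻¹) ^ 5 * ‖(B₈ : ℚ_[3])‖ ≤ (3⁻¹) ^ 5 * 1 := by gcongr; exact hm1 _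
        _ < 3⁻¹ * ‖x‖ ^ 4 := by nlinarith
    have hsum : ‖(3 * (B₂ : ℚ_[3])) * x ^ 3 + 3 * (27 * (B₄ : ℚ_[3])) * x ^ 2 + 3 * (81 * (B₆ : ℚ_[3])) * x +
        243 * (B₈ : ℚ_[3])‖ < 3⁻¹ * ‖x‖ ^ 4 :=
      lt_of_le_of_lt (Padic.nonarchimedean _ _) (max_lt (padic_norm_add3_lt t1 t2 t3) t4)
    rw [e, norm_neg] at hlead
    exact absurd hlead (ne_of_lt hsum)
  set xz : ℤ_[3] := ⟨x, hxle⟩ with hxz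
  have hxc : ((xz : ℤ_[3]) : ℚ_[3]) = x := rfl
  -- the two quantities, as integers
  have hD : 4 * x ^ 3 + 3 * ((B₂ : ℤ_[3]) : ℚ_[3]) * x ^ 2 + 2 * (27 * ((B₄ : ℤ_[3]) : ℚ_[3])) * x + 81 * ((B₆ : ℤ_[3]) : ℚ_[3]) =
      ((4 * xz ^ 3 + 3 * B₂ * xz ^ 2 + 54 * B₄ * xz + 81 * B₆ : ℤ_[3]) : ℚ_[3]) := by
    push_cast; rw [c3, c4, c54, c81, hxc]; ring
  have hA : 10 * (12 * x + 3 * ((B₂ : ℤ_[3]) : ℚ_[3])) ^ 2 -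
      9 * (9 * (((B₂ : ℤ_[3]) : ℚ_[3]) ^ 2 - 72 * ((B₄ : ℤ_[3]) : ℚ_[3]))) =
      ((10 * (12 * xz + 3 * B₂) ^ 2 - 81 * (B₂ ^ 2 - 72 * B₄) : ℤ_[3]) : ℚ_[3]) := by
    push_cast; rw [c3, c10, c12, c72, c81, hxc]; ring
  rw [hD, hA]
  by_cases hxu : IsUnit xz
  · ---------------------------------------------------------------- Case A: `x` a unit
    left
    -- `D = x³ + 3(…)` is a unit
    have hDu : IsUnit (4 * xz ^ 3 + 3 * B₂ * xz ^ 2 + 54 * B₄ * xz + 81 * B₆) := by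
      have e : 4 * xz ^ 3 + 3 * B₂ * xz ^ 2 + 54 * B₄ * xz + 81 * B₆ =
          xz ^ 3 + 3 * (xz ^ 2 * (xz + B₂) + 18 * B₄ * xz + 27 * B₆) := by ring
      rw [e]
      exact isUnit_add_mul_of_isUnit hirr (hxu.pow 3) _
    refine ⟨by rw [← PadicInt.norm_def]; exact PadicInt.isUnit_iff.mp hDu, ?_⟩
    -- `27 ∣ x + B₂` from the integer equation
    have hZ : 3 * xz ^ 4 + 3 * B₂ * xz ^ 3 + 81 * B₄ * xz ^ 2 + 243 * B₆ * xz + 243 * B₈ = 0 := by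
      have h : ((3 * xz ^ 4 + 3 * B₂ * xz ^ 3 + 81 * B₄ * xz ^ 2 + 243 * B₆ * xz + 243 * B₈ : ℤ_[3]) : ℚ_[3]) = 0 := by
        push_cast; rw [c3, c81, c243, hxc]; linear_combination hx
      exact PadicInt.coe_eq_zero.mp h
    obtain ⟨u, hu⟩ := (hxu.pow 3)
    have hdiv : ∃ w : ℤ_[3], xz + B₂ = 27 * w := by
      refine ⟨-(↑u⁻¹ * (B₄ * xz ^ 2 + 3 * B₆ * xz + 3 * B₈)), ?_⟩
      have h3ne : (3 : ℤ_[3]) ≠ 0 := hirr.ne_zero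
      have key : xz ^ 3 * (xz + B₂) = -(27 * (B₄ * xz ^ 2 + 3 * B₆ * xz + 3 * B₈)) := by
        apply mul_left_cancel₀ h3ne
        linear_combination hZ
      have hinv : (↑u⁻¹ : ℤ_[3]) * xz ^ 3 = 1 := by rw [← hu, Units.inv_mul]
      calc xz + B₂ = (↑u⁻¹ * xz ^ 3) * (xz + B₂) := by rw [hinv, one_mul]
        _ = ↑u⁻¹ * (xz ^ 3 * (xz + B₂)) := by ring
        _ = 27 * -(↑u⁻¹ * (B₄ * xz ^ 2 + 3 * B₆ * xz + 3 * B₈)) := by rw [key]; ring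
    obtain ⟨w, hw⟩ := hdiv
    have e : 10 * (12 * xz + 3 * B₂) ^ 2 - 81 * (B₂ ^ 2 - 72 * B₄) = 729 * (xz ^ 2 + 26 * w * xz + 9 * w ^ 2 + 8 * B₄) := by
      have hB : B₂ = 27 * w - xz := by linear_combination hw
      rw [hB]; ring
    rw [e, PadicInt.coe_mul, norm_mul, c729, show (729 : ℚ_[3]) = 3 ^ 6 by norm_num, norm_pow, h3n]
    exact mul_le_of_le_one_right (by positivity) (hm1 _)
  · ---------------------------------------------------------------- Case B: `3 ∣ x`
    right
    obtain ⟨z, hz⟩ := padicInt_three_eq_three_mul_of_not_isUnit hxu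
    have e : 4 * xz ^ 3 + 3 * B₂ * xz ^ 2 + 54 * B₄ * xz + 81 * B₆ = 27 * (4 * z ^ 3 + B₂ * z ^ 2 + 6 * B₄ * z + 3 * B₆) := by
      rw [hz]; ring
    refine ⟨?_, ?_⟩
    · rw [e, PadicInt.coe_mul, norm_mul, c27, show (27 : ℚ_[3]) = 3 ^ 3 by norm_num, norm_pow, h3n]
      exact mul_le_of_le_one_right (by positivity) (hm1 _)
    · -- `A = 9·(10(12z + B₂)² − 9(B₂² − 72B₄))` with `12z + B₂ ≡ α₂` a unit
      have eA : 10 * (12 * xz + 3 * B₂) ^ 2 - 81 * (B₂ ^ 2 - 72 * B₄) = 9 * (10 * (12 * z + B₂) ^ 2 - 9 * (B₂ ^ 2 - 72 * B₄)) := by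
        rw [hz]; ring
      have hU : IsUnit (10 * (12 * z + B₂) ^ 2 - 9 * (B₂ ^ 2 - 72 * B₄)) := by
        have hw : IsUnit (12 * z + B₂) := by
          have e1 : 12 * z + B₂ = α₂ + 3 * (4 * z + α₁ ^ 2 + α₂) := by rw [hB₂]; ring
          rw [e1]; exact isUnit_add_mul_of_isUnit hirr hα₂ _
        have e2 : 10 * (12 * z + B₂) ^ 2 - 9 * (B₂ ^ 2 - 72 * B₄) =
            (12 * z + B₂) ^ 2 + 3 * (3 * (12 * z + B₂) ^ 2 - 3 * (B₂ ^ 2 - 72 * B₄)) := by ring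
        rw [e2]; exact isUnit_add_mul_of_isUnit hirr (hw.pow 2) _
      have c9 : ((9 : ℤ_[3]) : ℚ_[3]) = 9 := by exact_mod_cast PadicInt.coe_natCast 9
      rw [eA, PadicInt.coe_mul, norm_mul, c9, show (9 : ℚ_[3]) = 3 ^ 2 by norm_num, norm_pow, h3n, ← PadicInt.norm_def,
        PadicInt.isUnit_iff.mp hU, mul_one]


/-! ### §2 Transport -/

/-- **The `Iₙ*` dichotomy for rational `3`-lines, sharpened:** `W` globally minimal of Kodaira type `Iₙ₊₁*` at `3`, `Ψ₃_W(q − b₂/12) = 0` ⟹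
(`ord₃ D₀ = 0` ∧ (`A = 0` ∨ `ord₃ A ≥ 6`)) ∨ (`ord₃ D₀ ≥ 3` ∧ `ord₃ A = 2`), `D₀ = Ψ₂²_W(q − b₂/12)`, `A = 1440q² − 9c₄(W)`.
[cite: SilvermanATAEC1994, IV.9.4 Step 7] [cite: DokchitserDokchitser2015LocalInvariants, Table 1] -/
theorem veluD₀_dichotomy_of_IstarSucc_three' (W : WeierstrassCurve ℚ) [W.IsElliptic] [W.IsGloballyMinimal] {n : ℕ}
    (hK : W.kodairaSymbolAt (placeOf 3) = .Istar (n + 1)) (q : ℚ) (hq : W.Ψ₃.eval (q - W.b₂ / 12) = 0) :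
    (padicValRat 3 (W.Ψ₂Sq.eval (q - W.b₂ / 12)) = 0 ∧
        (1440 * q ^ 2 - 9 * W.c₄ = 0 ∨ 6 ≤ padicValRat 3 (1440 * q ^ 2 - 9 * W.c₄))) ∨
      (3 ≤ padicValRat 3 (W.Ψ₂Sq.eval (q - W.b₂ / 12)) ∧ padicValRat 3 (1440 * q ^ 2 - 9 * W.c₄) = 2) := by
  haveI : Fact (Nat.Prime 3) := ⟨Nat.prime_three⟩
  have hKp : (((W.baseChange ℚ_[3]).minimal ℤ_[3]).integralModel ℤ_[3]).kodairaSymbolOfMinimal = .Istar (n + 1) := by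
    have e : Rat.HeightOneSpectrum.primesEquiv (R := ℤ) (placeOf 3) = ⟨3, Nat.prime_three⟩ := Equiv.apply_symm_apply _ _
    have h := WeierstrassCurve.kodairaSymbolAt_eq_padic (R := ℤ) (placeOf 3) W
    rw [e] at h
    change W.kodairaSymbolAt (placeOf 3) = (((W.baseChange ℚ_[3]).minimal ℤ_[3]).integralModel ℤ_[3]).kodairaSymbolOfMinimal at h
    rw [hK] at h
    exact h.symm
  set X : WeierstrassCurve ℚ_[3] := W.baseChange ℚ_[3] with hX
  set V₀ : WeierstrassCurve ℤ_[3] := (X.minimal ℤ_[3]).integralModel ℤ_[3] with hV₀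
  set E : WeierstrassCurve.VariableChange ℚ_[3] := (X.exists_isMinimal ℤ_[3]).choose with hE
  have hmin : X.minimal ℤ_[3] = E • X := rfl
  have hV₀X : V₀.baseChange ℚ_[3] = X.minimal ℤ_[3] := WeierstrassCurve.baseChange_integralModel_eq ℤ_[3] _
  have halg : algebraMap ℤ_[3] ℚ_[3] = PadicInt.Coe.ringHom := rfl
  have hrat : ∀ r : ℚ, algebraMap ℚ ℚ_[3] r = (r : ℚ_[3]) := fun r => by rw [eq_ratCast]
  have hXb₂ : X.b₂ = (W.b₂ : ℚ_[3]) := by rw [hX, WeierstrassCurve.baseChange, map_b₂, hrat]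
  have hXb₄ : X.b₄ = (W.b₄ : ℚ_[3]) := by rw [hX, WeierstrassCurve.baseChange, map_b₄, hrat]
  have hXb₆ : X.b₆ = (W.b₆ : ℚ_[3]) := by rw [hX, WeierstrassCurve.baseChange, map_b₆, hrat]
  have hXb₈ : X.b₈ = (W.b₈ : ℚ_[3]) := by rw [hX, WeierstrassCurve.baseChange, map_b₈, hrat]
  have hXc₄ : X.c₄ = (W.c₄ : ℚ_[3]) := by rw [hX, WeierstrassCurve.baseChange, map_c₄, hrat]
  have hXΔ : X.Δ = (W.Δ : ℚ_[3]) := by rw [hX, WeierstrassCurve.baseChange, map_Δ, hrat]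
  haveI : X.IsMinimal ℤ_[3] := isMinimal_baseChange_padic_of_isGloballyMinimal' W 3
  have hXΔ0 : X.Δ ≠ 0 := by
    rw [hXΔ]; exact_mod_cast (show W.Δ ≠ 0 by rw [← WeierstrassCurve.coe_Δ']; exact W.Δ'.ne_zero)
  have hminΔ : (X.minimal ℤ_[3]).Δ ≠ 0 := by
    rw [hmin, variableChange_Δ]; exact mul_ne_zero (pow_ne_zero _ (Units.ne_zero _)) hXΔ0
  have hV₀Δc : ((V₀.Δ : ℤ_[3]) : ℚ_[3]) = (X.minimal ℤ_[3]).Δ := by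
    rw [← hV₀X, WeierstrassCurve.baseChange, map_Δ, halg]; rfl
  obtain ⟨D, α₁, α₂, α₃, α₄, α₆, h₁, h₂, hα₂, h₃, h₄, h₆⟩ := exists_IstarSuccNormalForm_padicInt_three' V₀ hKp
  set Ctot : WeierstrassCurve.VariableChange ℚ_[3] := D.map (algebraMap ℤ_[3] ℚ_[3]) * E with hCtot
  have hCX : Ctot • X = (D • V₀).map (algebraMap ℤ_[3] ℚ_[3]) := by
    rw [hCtot, mul_smul, ← hmin, ← hV₀X]
    exact WeierstrassCurve.map_variableChange _ _ _
  set t : ℚ_[3] := ((q - W.b₂ / 12 : ℚ) : ℚ_[3]) with ht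
  have hqQ : 3 * (q - W.b₂ / 12) ^ 4 + W.b₂ * (q - W.b₂ / 12) ^ 3 + 3 * W.b₄ * (q - W.b₂ / 12) ^ 2 +
      3 * W.b₆ * (q - W.b₂ / 12) + W.b₈ = 0 := by
    simp only [WeierstrassCurve.Ψ₃, eval_add, eval_mul, eval_pow, eval_C, eval_X, eval_ofNat] at hq
    linear_combination hq
  have htX : 3 * t ^ 4 + X.b₂ * t ^ 3 + 3 * X.b₄ * t ^ 2 + 3 * X.b₆ * t + X.b₈ = 0 := by
    have h0 := congrArg (fun r : ℚ ↦ ((r : ℚ) : ℚ_[3])) hqQ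
    simp only [Rat.cast_add, Rat.cast_mul, Rat.cast_pow, Rat.cast_ofNat, Rat.cast_zero] at h0
    rw [hXb₂, hXb₄, hXb₆, hXb₈, ht]
    exact h0
  set x₁ : ℚ_[3] := ((Ctot.u⁻¹ : ℚ_[3]ˣ) : ℚ_[3]) ^ 2 * (t - Ctot.r) with hx₁
  have hroot : 3 * x₁ ^ 4 + ((D • V₀).map PadicInt.Coe.ringHom).b₂ * x₁ ^ 3 +
      3 * ((D • V₀).map PadicInt.Coe.ringHom).b₄ * x₁ ^ 2 + 3 * ((D • V₀).map PadicInt.Coe.ringHom).b₆ * x₁ +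
      ((D • V₀).map PadicInt.Coe.ringHom).b₈ = 0 := by
    have h := threeDivision_eval_smul X Ctot t
    rw [htX, mul_zero, hCX, halg] at h
    exact h
  have hloc := IstarSucc_root_dichotomy_padicInt' (D • V₀) h₁ h₂ hα₂ h₃ h₄ h₆ hroot
  have hDcov : 4 * x₁ ^ 3 + ((D • V₀).map PadicInt.Coe.ringHom).b₂ * x₁ ^ 2 +
      2 * ((D • V₀).map PadicInt.Coe.ringHom).b₄ * x₁ + ((D • V₀).map PadicInt.Coe.ringHom).b₆ =
      ((Ctot.u⁻¹ : ℚ_[3]ˣ) : ℚ_[3]) ^ 6 * ((W.Ψ₂Sq.eval (q - W.b₂ / 12) : ℚ) : ℚ_[3]) := by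
    have h := twoDivisionDisc_eval_smul X Ctot t
    rw [hCX, halg] at h
    rw [h]
    congr 1
    rw [hXb₂, hXb₄, hXb₆, ht]
    simp only [WeierstrassCurve.Ψ₂Sq, eval_add, eval_mul, eval_pow, eval_C, eval_X]
    push_cast; ring
  have hAcov : 10 * (12 * x₁ + ((D • V₀).map PadicInt.Coe.ringHom).b₂) ^ 2 - 9 * ((D • V₀).map PadicInt.Coe.ringHom).c₄ =
      ((Ctot.u⁻¹ : ℚ_[3]ˣ) : ℚ_[3]) ^ 4 * ((1440 * q ^ 2 - 9 * W.c₄ : ℚ) : ℚ_[3]) := by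
    rw [← halg, ← hCX, variableChange_b₂, variableChange_c₄, hx₁, hXb₂, hXc₄, ht]
    push_cast; ring
  have hnormmin : ‖(X.minimal ℤ_[3]).Δ‖ = ‖X.Δ‖ := by
    rw [Padic.norm_eq_zpow_neg_valuation hminΔ, Padic.norm_eq_zpow_neg_valuation hXΔ0, padicValuation_Δ_minimal_eq X hXΔ0]
  have hΔNF : (Ctot • X).Δ = ((((D.u⁻¹ : ℤ_[3]ˣ) : ℤ_[3]) ^ 12 * V₀.Δ : ℤ_[3]) : ℚ_[3]) := by
    rw [hCX, map_Δ, variableChange_Δ, halg]; rfl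
  have hnormNF : ‖(Ctot • X).Δ‖ = ‖X.Δ‖ := by
    rw [hΔNF]; push_cast
    rw [norm_mul, norm_pow, hV₀Δc, hnormmin]
    have hDu : ‖(((D.u⁻¹ : ℤ_[3]ˣ) : ℤ_[3]) : ℚ_[3])‖ = 1 := by
      rw [← PadicInt.norm_def]; exact PadicInt.isUnit_iff.mp (Units.isUnit _)
    rw [hDu, one_pow, one_mul]
  have hun : ‖((Ctot.u⁻¹ : ℚ_[3]ˣ) : ℚ_[3])‖ = 1 := by
    have h := hnormNF
    rw [variableChange_Δ, norm_mul, norm_pow] at h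
    have hX0 : ‖X.Δ‖ ≠ 0 := norm_ne_zero_iff.mpr hXΔ0
    have h12 : ‖((Ctot.u⁻¹ : ℚ_[3]ˣ) : ℚ_[3])‖ ^ 12 = 1 := mul_right_cancel₀ hX0 (h.trans (one_mul _).symm)
    exact (pow_eq_one_iff_of_nonneg (norm_nonneg _) (by norm_num)).mp h12
  have hD0 : W.Ψ₂Sq.eval (q - W.b₂ / 12) ≠ 0 := velu_three_Ψ₂Sq_ne_zero W q hq
  have hnorm : ∀ {r : ℚ}, r ≠ 0 → ‖(r : ℚ_[3])‖ = (3 : ℝ) ^ (-padicValRat 3 r) := fun {r} hr ↦ by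
    rw [Padic.eq_padicNorm, padicNorm.eq_zpow_of_nonzero hr]
    push_cast
    norm_num
  have hnD := hnorm hD0
  have h3 : (1 : ℝ) < 3 := by norm_num
  rcases hloc with ⟨hD1, hA6⟩ | ⟨hD3, hA2⟩
  · left
    rw [hDcov, norm_mul, norm_pow, hun, one_pow, one_mul, hnD] at hD1
    rw [hAcov, norm_mul, norm_pow, hun, one_pow, one_mul] at hA6
    refine ⟨?_, ?_⟩
    · have := (zpow_right_injective₀ (by norm_num : (0:ℝ) < 3) h3.ne') (hD1.trans (zpow_zero (3 : ℝ)).symm)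
      simpa using this
    · by_cases hA0 : (1440 * q ^ 2 - 9 * W.c₄ : ℚ) = 0
      · exact Or.inl hA0
      · right
        rw [hnorm hA0, show ((3 : ℝ)⁻¹) ^ 6 = (3 : ℝ) ^ (-6 : ℤ) by norm_num, zpow_le_zpow_iff_right₀ h3] at hA6
        omega
  · right
    rw [hDcov, norm_mul, norm_pow, hun, one_pow, one_mul, hnD,
      show ((3 : ℝ)⁻¹) ^ 3 = (3 : ℝ) ^ (-3 : ℤ) by norm_num, zpow_le_zpow_iff_right₀ h3] at hD3
    rw [hAcov, norm_mul, norm_pow, hun, one_pow, one_mul] at hA2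
    have hA0 : (1440 * q ^ 2 - 9 * W.c₄ : ℚ) ≠ 0 := by
      intro h0; rw [h0, Rat.cast_zero, norm_zero] at hA2; norm_num at hA2
    rw [hnorm hA0, show ((3 : ℝ)⁻¹) ^ 2 = (3 : ℝ) ^ (-2 : ℤ) by norm_num] at hA2
    have := zpow_right_injective₀ (by norm_num : (0:ℝ) < 3) h3.ne' hA2
    refine ⟨by omega, by simpa using this⟩


/-! ### §3 `ord₃ D₀ ≥ 3` on `Iₙ*` forces `u = 1`; the complete dichotomy -/

/-- `c₄` of a globally minimal curve over `ℚ` is an integer: `ord₃ c₄ ≥ 0` (or `c₄ = 0`). [cite: SilvermanAEC2009, VIII.8] -/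
theorem padicValRat_three_c₄_nonneg (W : WeierstrassCurve ℚ) [W.IsGloballyMinimal] : 0 ≤ padicValRat 3 W.c₄ := by
  have hc : W.c₄ = ((integralModelInt W).c₄ : ℚ) := by
    conv_lhs => rw [← map_integralModelInt W]
    rw [map_c₄, eq_intCast]
  rw [hc, padicValRat.of_int]
  positivity

/-- **On tame `Iₙ₊₁*` at `3`, a rational `3`-line with `ord₃ D₀ ≥ 3` has Néron scalar `u = 1`:** no globally minimal curve carries
`(3⁻⁴A, 3⁻⁶B)` (its `c₄ = 3⁻⁴A` would have `ord₃ = −2`), and an ISOGENOUS globally minimal curve carries `(A, B)`.  Unconditional.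
[cite: SilvermanATAEC1994, IV.9.4 Step 7, Table 4.1] [cite: DokchitserDokchitser2015LocalInvariants, Table 1] -/
theorem IstarSucc_velu_three_of_three_le_D₀ (W : WeierstrassCurve ℚ) [W.IsElliptic] [W.IsGloballyMinimal] {n : ℕ}
    (hK : W.kodairaSymbolAt (placeOf 3) = .Istar (n + 1)) (q : ℚ) (hq : W.Ψ₃.eval (q - W.b₂ / 12) = 0)
    (hD3 : 3 ≤ padicValRat 3 (W.Ψ₂Sq.eval (q - W.b₂ / 12))) :
    (¬ ∃ W' : WeierstrassCurve ℚ, W'.IsElliptic ∧ W'.IsGloballyMinimal ∧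
        (3 : ℚ) ^ 4 * W'.c₄ = 1440 * q ^ 2 - 9 * W.c₄ ∧
        (3 : ℚ) ^ 6 * W'.c₆ = 60480 * q ^ 3 - 756 * W.c₄ * q - 27 * W.c₆) ∧
      ∃ (W' : WeierstrassCurve ℚ) (_ : W'.IsElliptic) (_ : W'.IsGloballyMinimal), IsIsogenous W W' ∧
        W'.c₄ = 1440 * q ^ 2 - 9 * W.c₄ ∧ W'.c₆ = 60480 * q ^ 3 - 756 * W.c₄ * q - 27 * W.c₆ := by
  haveI : Fact (Nat.Prime 3) := ⟨Nat.prime_three⟩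
  have hA2 : padicValRat 3 (1440 * q ^ 2 - 9 * W.c₄) = 2 := by
    rcases veluD₀_dichotomy_of_IstarSucc_three' W hK q hq with ⟨h0, -⟩ | ⟨-, h⟩
    · omega
    · exact h
  have hA0 : (1440 * q ^ 2 - 9 * W.c₄ : ℚ) ≠ 0 := by
    intro h0; rw [h0, padicValRat.zero] at hA2; norm_num at hA2
  have hno : ¬ ∃ W' : WeierstrassCurve ℚ, W'.IsElliptic ∧ W'.IsGloballyMinimal ∧
      (3 : ℚ) ^ 4 * W'.c₄ = 1440 * q ^ 2 - 9 * W.c₄ ∧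
      (3 : ℚ) ^ 6 * W'.c₆ = 60480 * q ^ 3 - 756 * W.c₄ * q - 27 * W.c₆ := by
    rintro ⟨W', _, _, h4, -⟩
    have hc0 : W'.c₄ ≠ 0 := by
      intro h0; rw [h0, mul_zero] at h4; exact hA0 h4.symm
    have h3v : padicValRat 3 (3 : ℚ) = 1 := by exact_mod_cast padicValRat.self (p := 3) (by norm_num)
    have hv := congrArg (padicValRat 3) h4
    rw [padicValRat.mul (pow_ne_zero _ three_ne_zero) hc0, padicValRat.pow (3 : ℚ), h3v, hA2] at hv
    have hnn := padicValRat_three_c₄_nonneg W'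
    push_cast at hv
    omega
  refine ⟨hno, ?_⟩
  obtain ⟨W', k, hE', hM', hiso, hk, hk0, h4', h6', -⟩ := exists_isIsogenous_dvd_three_velu_three W q hq
  haveI := hE'; haveI := hM'
  rcases eq_or_eq_of_int_dvd_three hk with hk1 | hk3
  · have hk4 : (k : ℚ) ^ 4 = 1 := by rcases hk1 with rfl | rfl <;> norm_num
    have hk6 : (k : ℚ) ^ 6 = 1 := by rcases hk1 with rfl | rfl <;> norm_num
    rw [hk4, one_mul] at h4'
    rw [hk6, one_mul] at h6'
    exact ⟨W', hE', hM', hiso, h4', h6'⟩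
  · exfalso
    have hk4 : (k : ℚ) ^ 4 = 3 ^ 4 := by rcases hk3 with rfl | rfl <;> norm_num
    have hk6 : (k : ℚ) ^ 6 = 3 ^ 6 := by rcases hk3 with rfl | rfl <;> norm_num
    rw [hk4] at h4'
    rw [hk6] at h6'
    exact hno ⟨W', hE', hM', h4', h6'⟩

/-- **E-an-109 on tame `Iₙ*` (`n ≥ 1`), complete dichotomy for rational `3`-lines** (`9 ∣ N`, Kodaira type `Iₙ₊₁*` at `3`): either
`ord₃ D₀ = 0` and the line ASCENDS (`u = 3`: isogenous carrier of `(3⁻⁴A, 3⁻⁶B)`, no isogenous carrier of `(A, B)`), or `ord₃ D₀ ≥ 3` and the line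
does NOT ascend (`u = 1`: isogenous carrier of `(A, B)`, no carrier of `(3⁻⁴A, 3⁻⁶B)`).  Unconditional.
[cite: SilvermanATAEC1994, IV.9.4 Table 4.1] [cite: DokchitserDokchitser2015LocalInvariants, Table 1] -/
theorem IstarSucc_neronScalar_dichotomy (W : WeierstrassCurve ℚ) [W.IsElliptic] [W.IsGloballyMinimal] {n : ℕ}
    (h9 : 3 ^ 2 ∣ W.conductorNorm ℤ) (hK : W.kodairaSymbolAt (placeOf 3) = .Istar (n + 1)) (q : ℚ) (hq : W.Ψ₃.eval (q - W.b₂ / 12) = 0) :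
    (padicValRat 3 (W.Ψ₂Sq.eval (q - W.b₂ / 12)) = 0 ∧
      (∃ (W' : WeierstrassCurve ℚ) (_ : W'.IsElliptic) (_ : W'.IsGloballyMinimal), IsIsogenous W W' ∧
        (3 : ℚ) ^ 4 * W'.c₄ = 1440 * q ^ 2 - 9 * W.c₄ ∧
        (3 : ℚ) ^ 6 * W'.c₆ = 60480 * q ^ 3 - 756 * W.c₄ * q - 27 * W.c₆) ∧
      ¬ ∃ (W' : WeierstrassCurve ℚ) (_ : W'.IsElliptic) (_ : W'.IsGloballyMinimal), IsIsogenous W W' ∧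
        W'.c₄ = 1440 * q ^ 2 - 9 * W.c₄ ∧ W'.c₆ = 60480 * q ^ 3 - 756 * W.c₄ * q - 27 * W.c₆) ∨
    (3 ≤ padicValRat 3 (W.Ψ₂Sq.eval (q - W.b₂ / 12)) ∧
      (¬ ∃ W' : WeierstrassCurve ℚ, W'.IsElliptic ∧ W'.IsGloballyMinimal ∧
        (3 : ℚ) ^ 4 * W'.c₄ = 1440 * q ^ 2 - 9 * W.c₄ ∧
        (3 : ℚ) ^ 6 * W'.c₆ = 60480 * q ^ 3 - 756 * W.c₄ * q - 27 * W.c₆) ∧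
      ∃ (W' : WeierstrassCurve ℚ) (_ : W'.IsElliptic) (_ : W'.IsGloballyMinimal), IsIsogenous W W' ∧
        W'.c₄ = 1440 * q ^ 2 - 9 * W.c₄ ∧ W'.c₆ = 60480 * q ^ 3 - 756 * W.c₄ * q - 27 * W.c₆) := by
  rcases veluD₀_dichotomy_of_IstarSucc_three' W hK q hq with ⟨h0, -⟩ | ⟨h3, -⟩
  · exact Or.inl ⟨h0, IstarSucc_velu_three_of_D₀_unit W h9 hK q hq h0⟩
  · exact Or.inr ⟨h3, IstarSucc_velu_three_of_three_le_D₀ W hK q hq h3⟩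

end Summit.BirchSwinnertonDyer.BirchSwinnertonDyer.Theorems.ManinLocalTwoThree

end
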